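import Mathlib
import HarnessLib
import Summits.QuantumFields.YangMills.Theorems.PencilRigidityCurvatureKernelBoundTorusInfiniteVolumeComparison
import Literature.MathematicalPhysics.QuantumFieldTheory.YangMillsOS

/-!
# `CurvatureKernelBound` — lemmas for brick `SwapDiagonalVanishing` of the swap-mirror programme toward
# `Stub.FiniteCouplingStrongSubextensive` (crux stmt-QuantumFields-11687, line `coupling-trichotomy`)

Bookkeeping for the endgame of the swap-mirror programme (the truncated renormalised lattice two-point
function of the curvature at a fixed mirror pair `(g ∘ swap, g)` tends to `0` along the scheme):

* a shift sequence `u_k → ∞` with `u_k a_k → 0` along any sequence of spacings `a_k → 0⁺`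
  (`exists_shift_seq`);
* a uniform bound `a⁴ Σ_{x ∈ box} |f(a x)| ≤ M (2T + 1)⁴` for a bounded test function supported in
  `B̄(0, T)` and meshes `a ≤ 1` (`latticeSum_abs_le`);
* reindexing of lattice sums under a lattice translation that keeps the support inside the box
  (`sum_translate_eq`, `sum_sum_translate_swap`), membership of translated sites (`add_shift_mem_box`);
* evenness of a translation-invariant box limit `P(y − x) = lim ⟨Q_x Q_y⟩` (`even_of_hasBoxLimit`);
* translation invariance of the torus Wilson state in lifted form and the resulting invariance of the
  lattice ONE-point function under lattice translations of the test function
  (`integral_configShift_torusLift_eq`, `LatticeOneTranslate`);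
* supports of the mirrored and of the translated test function (`tsupport_swap_subset`,
  `tsupport_translate_subset_halfSpace`, `tsupport_translate_subset_closedBall`). [folklore]
-/

noncomputable section

open scoped BigOperators Topology SchwartzMap
open MeasureTheory Filter Set
open Literature.MathematicalPhysics.QuantumLattice Literature.MathematicalPhysics.QuantumFieldTheory
open Literature.Probability.LatticeModels (Site box mem_box card_box box_mono HasBoxLimit)

namespace Summit.QuantumFields.YangMills.Theorems.CurvatureKernel

namespace SwapDiagonal

/-! ## Real-variable lemmas -/

/-- Along spacings `a_k → 0⁺` there is an integer shift sequence `u_k → ∞` with `u_k a_k → 0`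
(`u_k = ⌈a_k^{-1/2}⌉`). [folklore] -/
theorem exists_shift_seq (a : ℕ → ℝ) (ha : ∀ k, 0 < a k) (h0 : Tendsto a atTop (𝓝 0)) :
    ∃ u : ℕ → ℕ, Tendsto (fun k => (u k : ℝ)) atTop atTop ∧
      Tendsto (fun k => (u k : ℝ) * a k) atTop (𝓝 0) := by
  have hsq : Tendsto (fun k => Real.sqrt (a k)) atTop (𝓝 0) := by
    have h := (Real.continuous_sqrt.tendsto 0).comp h0
    rwa [Function.comp_def, Real.sqrt_zero] at h
  refine ⟨fun k => ⌈(Real.sqrt (a k))⁻¹⌉₊, ?_, ?_⟩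
  · have h1 : Tendsto (fun k => Real.sqrt (a k)) atTop (𝓝[>] 0) :=
      tendsto_nhdsWithin_iff.2 ⟨hsq, Eventually.of_forall fun k => Real.sqrt_pos.2 (ha k)⟩
    exact tendsto_atTop_mono (fun k => Nat.le_ceil _) (tendsto_inv_nhdsGT_zero.comp h1)
  · have hsa : Tendsto (fun k => Real.sqrt (a k) + a k) atTop (𝓝 0) := by
      simpa using hsq.add h0
    refine squeeze_zero (fun k => mul_nonneg (Nat.cast_nonneg _) (ha k).le) (fun k => ?_) hsa
    have hs : 0 < Real.sqrt (a k) := Real.sqrt_pos.2 (ha k)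
    have e : (Real.sqrt (a k))⁻¹ * a k = Real.sqrt (a k) := by
      rw [inv_mul_eq_div, div_eq_iff hs.ne', Real.mul_self_sqrt (ha k).le]
    calc (⌈(Real.sqrt (a k))⁻¹⌉₊ : ℝ) * a k ≤ ((Real.sqrt (a k))⁻¹ + 1) * a k :=
          mul_le_mul_of_nonneg_right (Nat.ceil_lt_add_one (inv_nonneg.2 hs.le)).le (ha k).le
      _ = Real.sqrt (a k) + a k := by rw [add_mul, one_mul, e]

/-- Elementary product estimate used for the finite-size error terms:
`c K e (R₁ R₂) ≤ c e' (|K| C₁ C₂)` for `0 ≤ c`, `0 ≤ e ≤ e'`, `0 ≤ Rᵢ ≤ Cᵢ`. [folklore] -/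
theorem err_le {c K e e' R₁ R₂ C₁ C₂ : ℝ} (hc : 0 ≤ c) (he : 0 ≤ e) (hee : e ≤ e')
    (h1 : 0 ≤ R₁) (h1' : R₁ ≤ C₁) (h2 : 0 ≤ R₂) (h2' : R₂ ≤ C₂) :
    c * K * e * (R₁ * R₂) ≤ c * e' * (|K| * C₁ * C₂) := by
  have hC₁ : 0 ≤ C₁ := h1.trans h1'
  have he' : 0 ≤ e' := he.trans hee
  calc c * K * e * (R₁ * R₂) = K * (c * e * R₁ * R₂) := by ring
    _ ≤ |K| * (c * e * R₁ * R₂) := mul_le_mul_of_nonneg_right (le_abs_self K) (by positivity)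
    _ ≤ |K| * (c * e' * C₁ * C₂) := by
        refine mul_le_mul_of_nonneg_left ?_ (abs_nonneg K)
        gcongr
    _ = c * e' * (|K| * C₁ * C₂) := by ring

/-! ## Lattice sums -/

/-- **Uniform lattice point count.** For a test function `f` with `|f| ≤ M` supported in `B̄(0, T)`
and meshes `0 < a ≤ 1`: `a⁴ Σ_{x ∈ box} |f(a x)| ≤ M (2T + 1)⁴` (the contributing sites lie in
`[-⌊T/a⌋, ⌊T/a⌋]⁴`, which has `(2⌊T/a⌋ + 1)⁴ ≤ ((2T + 1)/a)⁴` points). [folklore] -/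
theorem latticeSum_abs_le {f : 𝓢(EuclideanSpace ℝ (Fin 4), ℝ)} {T a M : ℝ} (hT : 0 ≤ T)
    (hf : tsupport (f : EuclideanSpace ℝ (Fin 4) → ℝ) ⊆ Metric.closedBall 0 T) (hM : ∀ z, |f z| ≤ M)
    (ha : 0 < a) (ha1 : a ≤ 1) (L : ℕ) :
    a ^ 4 * ∑ x ∈ box 4 L, |f (a • siteToE x)| ≤ M * (2 * T + 1) ^ 4 := by
  have hM0 : 0 ≤ M := (abs_nonneg _).trans (hM 0)
  set N : ℕ := ⌊T / a⌋₊ with hN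
  have hsum : ∑ x ∈ box 4 L, |f (a • siteToE x)| ≤ M * (2 * N + 1) ^ 4 := by
    calc ∑ x ∈ box 4 L, |f (a • siteToE x)|
        = ∑ x ∈ (box 4 L).filter (fun x => x ∈ box 4 N), |f (a • siteToE x)| := by
          rw [Finset.sum_filter_of_ne]
          intro x _ hx
          exact mem_box_floor_of_apply_ne_zero hf ha (abs_ne_zero.1 hx)
      _ ≤ ∑ x ∈ (box 4 L).filter (fun x => x ∈ box 4 N), M := Finset.sum_le_sum fun x _ => hM _
      _ = (((box 4 L).filter (fun x => x ∈ box 4 N)).card : ℝ) * M := by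
          rw [Finset.sum_const, nsmul_eq_mul]
      _ ≤ ((box 4 N).card : ℝ) * M := by
          refine mul_le_mul_of_nonneg_right ?_ hM0
          exact_mod_cast Finset.card_le_card fun x hx => (Finset.mem_filter.1 hx).2
      _ = M * (2 * N + 1) ^ 4 := by rw [card_box]; push_cast; ring
  have hNle : (N : ℝ) ≤ T / a := Nat.floor_le (div_nonneg hT ha.le)
  have hkey : a * (2 * N + 1) ≤ 2 * T + 1 := by
    have h1 : a * N ≤ T := by
      have := mul_le_mul_of_nonneg_left hNle ha.le
      rwa [mul_div_cancel₀ _ ha.ne'] at this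
    nlinarith
  calc a ^ 4 * ∑ x ∈ box 4 L, |f (a • siteToE x)| ≤ a ^ 4 * (M * (2 * N + 1) ^ 4) :=
        mul_le_mul_of_nonneg_left hsum (by positivity)
    _ = M * (a * (2 * N + 1)) ^ 4 := by ring
    _ ≤ M * (2 * T + 1) ^ 4 :=
        mul_le_mul_of_nonneg_left (pow_le_pow_left₀ (by positivity) hkey 4) hM0

/-- **Reindexing a lattice sum under a translation** that keeps the support inside the box: if every
`y` with `φ y ≠ 0` has `y, y + s ∈ B` then `Σ_{y ∈ B} φ(y − s) = Σ_{y ∈ B} φ(y)`. [folklore] -/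
theorem sum_translate_eq {φ : Site 4 → ℝ} {B : Finset (Site 4)} (s : Site 4)
    (hB : ∀ y, φ y ≠ 0 → y ∈ B ∧ y + s ∈ B) :
    ∑ y ∈ B, φ (y - s) = ∑ y ∈ B, φ y := by
  refine Finset.sum_bij_ne_zero (fun y _ _ => y - s) (fun y _ hy => (hB _ hy).1)
    (fun y₁ _ _ y₂ _ _ h => sub_left_injective h) (fun y hy hne => ?_) (fun y _ _ => rfl)
  exact ⟨y + s, (hB y hne).2, by rwa [add_sub_cancel_right], add_sub_cancel_right y s⟩

/-- **Reindexing the double sum.** Under the same support condition on `G`,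
`Σ_x Σ_y H(x) G(y − s) K(y − x) = Σ_x Σ_y G(x) H(y) K(x + s − y)` (translate the inner variable, then
exchange the order of summation). [folklore] -/
theorem sum_sum_translate_swap {G H K : Site 4 → ℝ} {B : Finset (Site 4)} (s : Site 4)
    (hB : ∀ y, G y ≠ 0 → y ∈ B ∧ y + s ∈ B) :
    ∑ x ∈ B, ∑ y ∈ B, H x * G (y - s) * K (y - x) =
      ∑ x ∈ B, ∑ y ∈ B, G x * H y * K (x + s - y) := by
  have hinner : ∀ x, ∑ y ∈ B, H x * G (y - s) * K (y - x) =
      ∑ y ∈ B, H x * G y * K (y + s - x) := by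
    intro x
    have h := sum_translate_eq (φ := fun y => H x * G y * K (y + s - x)) (B := B) s
      (fun y hy => hB y fun h0 => hy (by rw [h0, mul_zero, zero_mul]))
    simpa only [sub_add_cancel] using h
  simp only [hinner]
  rw [Finset.sum_comm]
  refine Finset.sum_congr rfl fun x _ => Finset.sum_congr rfl fun y _ => ?_
  ring

/-- **The double lattice sum against a lattice translate, reindexed.** For an even `P` and a lattice
vector `s` keeping the support of `f'` inside the box,
`Σ_x Σ_y f(a x) f'(a (y − s)) (P(y − x) − c) = Σ_x Σ_y f'(a x) f(a y) (P(y − x − s) − c)`. [folklore] -/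
theorem sum_sum_lattice_translate (f f' : 𝓢(EuclideanSpace ℝ (Fin 4), ℝ)) (P : Site 4 → ℝ) (c a : ℝ)
    (B : Finset (Site 4)) (s : Site 4)
    (hB : ∀ y, f' (a • siteToE y) ≠ 0 → y ∈ B ∧ y + s ∈ B) (hP : ∀ z, P (-z) = P z) :
    ∑ x ∈ B, ∑ y ∈ B, f (a • siteToE x) * f' (a • siteToE (y - s)) * (P (y - x) - c) =
      ∑ x ∈ B, ∑ y ∈ B, f' (a • siteToE x) * f (a • siteToE y) * (P (y - x - s) - c) := by
  rw [sum_sum_translate_swap (G := fun y => f' (a • siteToE y)) (H := fun x => f (a • siteToE x))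
    (K := fun z => P z - c) s hB]
  refine Finset.sum_congr rfl fun x _ => Finset.sum_congr rfl fun y _ => ?_
  rw [show x + s - y = -(y - x - s) by abel, hP]

/-- **Symmetry of the double lattice sum** for an even `P`:
`Σ_x Σ_y f(a x) f'(a y) (P(y − x) − c) = Σ_x Σ_y f'(a x) f(a y) (P(y − x) − c)`. [folklore] -/
theorem sum_sum_swap_even (f f' : 𝓢(EuclideanSpace ℝ (Fin 4), ℝ)) (P : Site 4 → ℝ) (c a : ℝ)
    (B : Finset (Site 4)) (hP : ∀ z, P (-z) = P z) :
    ∑ x ∈ B, ∑ y ∈ B, f (a • siteToE x) * f' (a • siteToE y) * (P (y - x) - c) =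
      ∑ x ∈ B, ∑ y ∈ B, f' (a • siteToE x) * f (a • siteToE y) * (P (y - x) - c) := by
  rw [Finset.sum_comm]
  refine Finset.sum_congr rfl fun x _ => Finset.sum_congr rfl fun y _ => ?_
  rw [show x - y = -(y - x) by abel, hP]
  ring

/-- Coordinates of the mirror vector `v = e₀ − e₁` are bounded by `1`. [folklore] -/
theorem abs_mirrorVec_apply_le (i : Fin 4) :
    |(Pi.single 0 (1 : ℤ) - Pi.single 1 (1 : ℤ) : Site 4) i| ≤ 1 := by
  fin_cases i <;> simp

/-- A site of `[-M, M]⁴` translated by `2n (e₀ − e₁)` lies in `[-L, L]⁴` once `M + 2n ≤ L`.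
[folklore] -/
theorem add_shift_mem_box {y : Site 4} {M n L : ℕ} (hy : y ∈ box 4 M) (hML : M + 2 * n ≤ L) :
    y + ((2 * n : ℕ) : ℤ) • (Pi.single 0 (1 : ℤ) - Pi.single 1 (1 : ℤ) : Site 4) ∈ box 4 L := by
  rw [mem_box] at hy ⊢
  intro i
  have h1 := hy i
  have h2 := abs_mirrorVec_apply_le i
  rw [abs_le] at h2
  have hML' : (M : ℤ) + 2 * n ≤ L := by exact_mod_cast hML
  simp only [Pi.add_apply, Pi.smul_apply, smul_eq_mul, Nat.cast_mul, Nat.cast_ofNat]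
  constructor <;> nlinarith [h1.1, h1.2, h2.1, h2.2]

/-- A site of `[-M, M]⁴` lies in `[-L, L]⁴` for `M ≤ L`. [folklore] -/
theorem mem_box_of_le {y : Site 4} {M L : ℕ} (hy : y ∈ box 4 M) (hML : M ≤ L) : y ∈ box 4 L :=
  box_mono 4 hML hy

/-- `siteToE` commutes with integer scalings. [folklore] -/
theorem siteToE_zsmul (m : ℤ) (x : Site 4) : siteToE (m • x) = (m : ℝ) • siteToE x := by
  ext i
  simp [siteToE_apply]

/-! ## Box limits -/

/-- **Evenness of the translation-invariant pair limit.** If `P(y − x)` is the box limit of the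
expectations of `Q_x Q_y` for all `x, y`, then `P(−z) = P(z)` (`Q_0 Q_z = Q_z Q_0`, uniqueness of
limits). [folklore] -/
theorem even_of_hasBoxLimit {Ω : Type*} (E : Finset (Site 4) → (Ω → ℝ) → ℝ) (Q : Site 4 → Ω → ℝ)
    (P : Site 4 → ℝ) (hP : ∀ x y : Site 4, HasBoxLimit (fun Λ => E Λ (fun U => Q x U * Q y U)) (P (y - x)))
    (z : Site 4) : P (-z) = P z := by
  have h1 := hP 0 z
  have h2 := hP z 0
  rw [sub_zero] at h1
  rw [zero_sub] at h2
  have hfun : (fun Λ => E Λ (fun U => Q z U * Q 0 U)) = fun Λ => E Λ (fun U => Q 0 U * Q z U) := by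
    funext Λ
    simp only [mul_comm]
  rw [hfun] at h2
  exact tendsto_nhds_unique h2 h1

/-! ## Translation invariance of the torus Wilson state and of the lattice one-point function -/

section Lattice

variable {G : Type} [Group G] [TopologicalSpace G] [IsTopologicalGroup G] [CompactSpace G]
  [MeasurableSpace G] [BorelSpace G]

/-- Translation invariance of the torus Wilson state, in lifted form:
`∫ B(θ_v Ũ) dμ = ∫ B(Ũ) dμ` (`Ũ` the periodic lift). [folklore] -/
theorem integral_configShift_torusLift_eq {N : ℕ} (ρ : G →* Matrix (Fin N) (Fin N) ℂ) (β : ℝ)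
    (S : ℕ) [NeZero S] (B : LGConfig 4 G → ℝ) (v : Site 4) :
    ∫ U, B (configShift v (torusLift S U)) ∂(wilsonMeasure (d := 4) (L := S) ρ β) =
      ∫ U, B (torusLift S U) ∂(wilsonMeasure (d := 4) (L := S) ρ β) := by
  -- adapted from `LatticeGapOnTrajectory/Negative/ZeroCoupling.lean`
  have h := wilsonExpectation_comp_torusConfigShift (d := 4) (L := S) ρ β
    (Literature.Probability.LatticeModels.Torus.proj S v) (toTorusObservable S B)
  rw [← toTorusObservable_comp_configShift] at h
  simpa [wilsonExpectation, toTorusObservable, Function.comp_apply] using h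

end Lattice

end SwapDiagonal

/-- **Lattice translations do not change the renormalised one-point function.** If the lattice sums of
two test functions over the box agree, `Σ_{x ∈ box} h(a_k x) = Σ_{x ∈ box} f(a_k x)` (e.g. `h` a
translate of `f` by a lattice vector keeping the support inside the box), then the renormalised
lattice one-point functions of the curvature agree: `LS₁(h) = LS₁(f)` — the torus Wilson state is
translation invariant, so `LS₁(f) = c_k (⟨Q⟩ − m_k) a_k⁴ Σ_x f(a_k x)`. [folklore] -/
theorem LatticeOneTranslate : ∀ {G : Type} [Group G] [TopologicalSpace G] [IsTopologicalGroup G] [CompactSpace G] [MeasurableSpace G] [BorelSpace G] (r : Literature.MathematicalPhysics.QuantumFieldTheory.LatticeRep G) (sch : Literature.MathematicalPhysics.QuantumFieldTheory.SpeciesScheme (Literature.MathematicalPhysics.QuantumFieldTheory.YMSpecies G)) (k : ℕ) (f h : SchwartzMap (EuclideanSpace ℝ (Fin 4)) ℝ), ∑ x ∈ Literature.Probability.LatticeModels.box 4 (sch.L k), h (sch.a k • Literature.MathematicalPhysics.QuantumLattice.siteToE x) = ∑ x ∈ Literature.Probability.LatticeModels.box 4 (sch.L k), f (sch.a k • Literature.MathematicalPhysics.QuantumLattice.siteToE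 x) → Literature.MathematicalPhysics.QuantumFieldTheory.latticeSchwinger r.ρ sch (fun s => s.F) k 1 (fun _ => r.curvature) (fun _ => h) = Literature.MathematicalPhysics.QuantumFieldTheory.latticeSchwinger r.ρ sch (fun s => s.F) k 1 (fun _ => r.curvature) (fun _ => f) := by
  intro G _ _ _ _ _ _ r sch k f h hsum
  rw [latticeSchwinger_one_eq r.ρ r.continuous sch (fun s => s.F) k (fun _ => r.curvature) (fun _ => h)
      r.curvature.measurable r.curvature.bounded,
    latticeSchwinger_one_eq r.ρ r.continuous sch (fun s => s.F) k (fun _ => r.curvature) (fun _ => f)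
      r.curvature.measurable r.curvature.bounded]
  have hI : ∀ x : Site 4,
      ∫ U, (r.curvature.F (configShift (-x) (torusLift (sch.side k) U)) - sch.m r.curvature k)
        ∂(wilsonMeasure (d := 4) (L := sch.side k) r.ρ (sch.β k)) =
      ∫ U, (r.curvature.F (torusLift (sch.side k) U) - sch.m r.curvature k)
        ∂(wilsonMeasure (d := 4) (L := sch.side k) r.ρ (sch.β k)) := fun x =>
    SwapDiagonal.integral_configShift_torusLift_eq r.ρ (sch.β k) (sch.side k)
      (fun V => r.curvature.F V - sch.m r.curvature k) (-x)
  simp only [hI, ← Finset.sum_mul]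
  rw [hsum]

namespace SwapDiagonal

/-! ## Supports of the mirrored and translated test functions -/

/-- The coordinate difference `z ↦ z 0 − z 1` is continuous on `ℝ⁴`. [folklore] -/
theorem continuous_coord_sub : Continuous fun z : EuclideanSpace ℝ (Fin 4) => z 0 - z 1 := by
  fun_prop

/-- The coordinate swap `0 ↔ 1` preserves the Euclidean norm. [folklore] -/
theorem norm_swap_eq (z : EuclideanSpace ℝ (Fin 4)) :
    ‖(WithLp.toLp 2 fun i => z (Equiv.swap (0 : Fin 4) 1 i) : EuclideanSpace ℝ (Fin 4))‖ = ‖z‖ := by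
  rw [EuclideanSpace.norm_eq, EuclideanSpace.norm_eq]
  congr 1
  exact Equiv.sum_comp (Equiv.swap (0 : Fin 4) 1) (fun i => ‖z i‖ ^ 2)

/-- **Support of the mirror image.** If `g` is supported in `{δ ≤ z 0 − z 1} ∩ B̄(0, T)` then
`gθ = g ∘ swap₀₁` is supported in `{z 0 − z 1 ≤ −δ} ∩ B̄(0, T)`. [folklore] -/
theorem tsupport_swap_subset {g gθ : 𝓢(EuclideanSpace ℝ (Fin 4), ℝ)} {δ T : ℝ}
    (hg : ∀ z ∈ tsupport (g : EuclideanSpace ℝ (Fin 4) → ℝ), δ ≤ z 0 - z 1)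
    (hgT : tsupport (g : EuclideanSpace ℝ (Fin 4) → ℝ) ⊆ Metric.closedBall 0 T)
    (hθ : ∀ z : EuclideanSpace ℝ (Fin 4), gθ z = g (WithLp.toLp 2 (fun i => z (Equiv.swap (0 : Fin 4) 1 i)))) :
    tsupport (gθ : EuclideanSpace ℝ (Fin 4) → ℝ) ⊆
      {z : EuclideanSpace ℝ (Fin 4) | z 0 - z 1 ≤ -δ} ∩ Metric.closedBall 0 T := by
  refine closure_minimal (fun z hz => ?_)
    ((isClosed_le continuous_coord_sub continuous_const).inter Metric.isClosed_closedBall)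
  have hz' : g (WithLp.toLp 2 (fun i => z (Equiv.swap (0 : Fin 4) 1 i))) ≠ 0 := by
    rwa [← hθ]
  have hmem := subset_tsupport _ (Function.mem_support.2 hz')
  have h1 := hg _ hmem
  have h2 := hgT hmem
  rw [Metric.mem_closedBall, dist_zero_right, norm_swap_eq] at h2
  simp only [Equiv.swap_apply_left, Equiv.swap_apply_right] at h1
  refine ⟨?_, ?_⟩
  · show z 0 - z 1 ≤ -δ
    linarith
  · rwa [Metric.mem_closedBall, dist_zero_right]

/-- **Support of a translate, half-space part.** Translating `g` (supported in `{δ ≤ z 0 − z 1}`) by a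
vector `w` with `0 ≤ w 0 − w 1` keeps the support in `{δ ≤ z 0 − z 1}`. [folklore] -/
theorem tsupport_translate_subset_halfSpace {g : 𝓢(EuclideanSpace ℝ (Fin 4), ℝ)} {δ : ℝ}
    (hg : ∀ z ∈ tsupport (g : EuclideanSpace ℝ (Fin 4) → ℝ), δ ≤ z 0 - z 1)
    (w : EuclideanSpace ℝ (Fin 4)) (hw : 0 ≤ w 0 - w 1) :
    tsupport ((SchwartzMap.compSubConstCLM ℝ w g : 𝓢(EuclideanSpace ℝ (Fin 4), ℝ)) :
        EuclideanSpace ℝ (Fin 4) → ℝ) ⊆ {z : EuclideanSpace ℝ (Fin 4) | δ ≤ z 0 - z 1} := by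
  refine closure_minimal (fun z hz => ?_) (isClosed_le continuous_const continuous_coord_sub)
  have hz' : g (z - w) ≠ 0 := by
    rwa [Function.mem_support, SchwartzMap.compSubConstCLM_apply] at hz
  have h1 := hg _ (subset_tsupport _ (Function.mem_support.2 hz'))
  simp only [PiLp.sub_apply] at h1
  show δ ≤ z 0 - z 1
  linarith

/-- **Support of a translate, ball part.** Translating `g` (supported in `B̄(0, T)`) by `w` puts the
support in `B̄(0, T + ‖w‖)`. [folklore] -/
theorem tsupport_translate_subset_closedBall {g : 𝓢(EuclideanSpace ℝ (Fin 4), ℝ)} {T : ℝ}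
    (hgT : tsupport (g : EuclideanSpace ℝ (Fin 4) → ℝ) ⊆ Metric.closedBall 0 T)
    (w : EuclideanSpace ℝ (Fin 4)) :
    tsupport ((SchwartzMap.compSubConstCLM ℝ w g : 𝓢(EuclideanSpace ℝ (Fin 4), ℝ)) :
        EuclideanSpace ℝ (Fin 4) → ℝ) ⊆ Metric.closedBall 0 (T + ‖w‖) := by
  refine closure_minimal (fun z hz => ?_) Metric.isClosed_closedBall
  have hz' : g (z - w) ≠ 0 := by
    rwa [Function.mem_support, SchwartzMap.compSubConstCLM_apply] at hz
  have h2 := hgT (subset_tsupport _ (Function.mem_support.2 hz'))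
  rw [Metric.mem_closedBall, dist_zero_right] at h2 ⊢
  calc ‖z‖ = ‖(z - w) + w‖ := by rw [sub_add_cancel]
    _ ≤ ‖z - w‖ + ‖w‖ := norm_add_le _ _
    _ ≤ T + ‖w‖ := by linarith

/-- One-point test functions are automatically off-diagonal. [folklore] -/
theorem isOffDiagonal_fin_one (F : 𝓢((Fin 1 → EuclideanSpace ℝ (Fin 4)), ℂ)) :
    Literature.MathematicalPhysics.AQFT.IsOffDiagonal F := by
  -- adapted from `HypercubicLimit/Negative/NonabelianLoadBearing.lean`
  rintro x ⟨i, j, hij, -⟩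
  exact absurd (Subsingleton.elim i j) hij

end SwapDiagonal

end Summit.QuantumFields.YangMills.Theorems.CurvatureKernel

end
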